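import Literature.Probability.RandomPlanarGeometry.HullUniformizer
import Literature.Probability.RandomPlanarGeometry.HullDecomposition
import Literature.Probability.RandomPlanarGeometry.HullApproximation
import Literature.Probability.RandomPlanarGeometry.RestrictionHullsProofs
import Literature.Probability.RandomPlanarGeometry.RestrictionHullsRiemannProofs
import HarnessLib

/-!
# The maps `Φ_A` of `*`-hulls: existence, uniqueness, `Φ_A'(0) ∈ (0, 1]`, and `A = A₁ · A₂` (LSW 2003, §2) — discharged

G. F. Lawler, O. Schramm, W. Werner, *Conformal restriction: the chordal case*, J. Amer. Math.
Soc. **16** (2003) 917–955, arXiv:math/0209343 (**[LSW]**, arXiv page numbers), §2 pp. 7–8.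
This file DISCHARGES the named fact

* `Literature.Probability.RandomPlanarGeometry.IsStarHull.exists_isHullProduct_plus_minus_holds` — "If `A ∈ 𝒬*`, then we can find …
  `A₁ ∈ 𝒬₊` and `A₂ ∈ 𝒬₋` such that `A = A₁ · A₂`" (§2 p. 8; fact of `HullApproximation`),

and gives a second, independent proof of the existence of `Φ_A` with `Φ_A'(0) ∈ (0, 1]` for every
`*`-hull TOGETHER WITH the behaviour of `Φ_A⁻¹` at `0` and at `∞`
(`Literature.Probability.RandomPlanarGeometry.IsStarHull.exists_restrictionMap_tendsto`), which is what the factorisation and the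
monotonicity of `Φ_A'(0)` in the hull (`HullSubordination`) consume. (The named facts
`IsStarHull.existsUnique_isRestrictionMap` and `IsStarHull.exists_hasRestrictionDeriv` of
`RestrictionHulls` are discharged in the tree by `RestrictionHullsRiemannProofs` /
`RestrictionHullsProofs`, by symmetric Riemann maps at `∞` and at `0`; the uniqueness statement
used below is `IsRestrictionMap.eqOn_of_tendsto_symm` of `HullUniformizer`.)

Proof architecture. `HullUniformizer` constructs `Φ_A` together with its injective holomorphic
symmetric extension `E` to the symmetrized slit domain `Ω ∋ 0`, and proves everything for
ONE-SIDED hulls (`IsSlitHull`); `HullDecomposition` splits a `*`-hull as `A = A₊ ⊔ A₋` with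
`A₊ ∈ 𝒬₊`, `A₋ ∈ 𝒬₋` (unions of components). Here:

1. nonempty `±`-hulls carry slit data (`IsPlusHull.isSlitHull`, `IsMinusHull.isSlitHull`:
   `[p, q] = [x₀/2, x₁]`, resp. `[x₁/2, x₀]`, `x₀ = inf (A ∩ ℝ)`, `x₁ = sup (A ∩ ℝ)`);
2. for two-sided `A`, with `E₋` the extension of `Φ_{A₋}` (`A₊ ⊆ Ω₋`): `B := E₋(A₊)` is a nonempty
   `+`-hull without floating pieces, `ℍ ∖ B = E₋(ℍ ∖ A)` (`E₋` is increasing on the real ray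
   through `0`, so `E₋(A₊ ∩ ℝ) ⊆ (0, ∞)`), and `Φ_A := Φ_B ∘ E₋|` is a restriction map of `A`
   with `Φ_A⁻¹ → 0` at `0` and `→ ∞` at `∞`, and `Φ_A'(0) = Φ_B'(0) Φ_{A₋}'(0) ∈ (0, 1]`;
   this is `A = B · A₋` in the sense of `RestrictionConfig.IsHullProduct`;
3. uniqueness in all cases is `IsRestrictionMap.eqOn_of_tendsto_symm` (`HullUniformizer`).
-/

noncomputable section

open Set Filter Topology Metric Bornology Complex
open UpperHalfPlane (upperHalfPlaneSet isOpen_upperHalfPlaneSet)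
open scoped ComplexConjugate

namespace Literature.Probability.RandomPlanarGeometry

variable {A : Set ℂ}

/-! ### Slit data for nonempty `±`-hulls -/

/-- A nonempty `+`-hull is a one-sided hull with slit data `(x₀/2, x₁)`, `x₀ = inf (A ∩ ℝ) > 0`,
`x₁ = sup (A ∩ ℝ)`. [folklore] -/
theorem IsPlusHull.isSlitHull (hA : IsPlusHull A) (hne : A.Nonempty) :
    IsSlitHull A (sInf (realTrace A) / 2) (sSup (realTrace A)) := by
  have hT : IsCompact (realTrace A) := isCompact_realTrace hA.1.isBoundedHull.isCompact
  have hTne : (realTrace A).Nonempty := hA.1.isBoundedHull.realTrace_nonempty hne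
  have hm : sInf (realTrace A) ∈ realTrace A := hT.sInf_mem hTne
  have hm0 : 0 < sInf (realTrace A) := hA.2 _ hm
  have hle : ∀ x ∈ realTrace A, sInf (realTrace A) ≤ x ∧ x ≤ sSup (realTrace A) := fun x hx ↦
    ⟨csInf_le hT.bddBelow hx, le_csSup hT.bddAbove hx⟩
  have hmM : sInf (realTrace A) ≤ sSup (realTrace A) := (hle _ hm).2
  have hI : uIcc (sInf (realTrace A) / 2) (sSup (realTrace A)) =
      Icc (sInf (realTrace A) / 2) (sSup (realTrace A)) := uIcc_of_le (by linarith)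
  refine ⟨hA.1, hne, hA.1.isBoundedHull.isConnected_union_im_nonpos, ?_, fun x hx ↦ ?_⟩
  · rw [hI]
    exact fun h ↦ by linarith [h.1]
  · have := hle x hx
    rw [hI]
    exact ⟨⟨by linarith, this.2⟩, fun h ↦ by linarith⟩

/-- A nonempty `−`-hull is a one-sided hull with slit data `(x₁/2, x₀)`, `x₁ = sup (A ∩ ℝ) < 0`,
`x₀ = inf (A ∩ ℝ)`. [folklore] -/
theorem IsMinusHull.isSlitHull (hA : IsMinusHull A) (hne : A.Nonempty) :
    IsSlitHull A (sSup (realTrace A) / 2) (sInf (realTrace A)) := by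
  have hT : IsCompact (realTrace A) := isCompact_realTrace hA.1.isBoundedHull.isCompact
  have hTne : (realTrace A).Nonempty := hA.1.isBoundedHull.realTrace_nonempty hne
  have hM : sSup (realTrace A) ∈ realTrace A := hT.sSup_mem hTne
  have hM0 : sSup (realTrace A) < 0 := hA.2 _ hM
  have hle : ∀ x ∈ realTrace A, sInf (realTrace A) ≤ x ∧ x ≤ sSup (realTrace A) := fun x hx ↦
    ⟨csInf_le hT.bddBelow hx, le_csSup hT.bddAbove hx⟩
  have hmM : sInf (realTrace A) ≤ sSup (realTrace A) := (hle _ hM).1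
  have hI : uIcc (sSup (realTrace A) / 2) (sInf (realTrace A)) =
      Icc (sInf (realTrace A)) (sSup (realTrace A) / 2) := uIcc_of_ge (by linarith)
  refine ⟨hA.1, hne, hA.1.isBoundedHull.isConnected_union_im_nonpos, ?_, fun x hx ↦ ?_⟩
  · rw [hI]
    exact fun h ↦ by linarith [h.2]
  · have := hle x hx
    rw [hI]
    exact ⟨⟨this.1, by linarith⟩, fun h ↦ by linarith⟩

/-- The slit data of a nonempty `−`-hull are negative. [folklore] -/
theorem IsMinusHull.slit_neg (hA : IsMinusHull A) (hne : A.Nonempty) :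
    max (sSup (realTrace A) / 2) (sInf (realTrace A)) < 0 := by
  have hT : IsCompact (realTrace A) := isCompact_realTrace hA.1.isBoundedHull.isCompact
  have hTne : (realTrace A).Nonempty := hA.1.isBoundedHull.realTrace_nonempty hne
  have hM : sSup (realTrace A) ∈ realTrace A := hT.sSup_mem hTne
  have hM0 : sSup (realTrace A) < 0 := hA.2 _ hM
  have hmM : sInf (realTrace A) ≤ sSup (realTrace A) := csInf_le hT.bddBelow hM
  exact max_lt (by linarith) (by linarith)

/-! ### The extension `E` on the real ray through `0` and in the lower half-plane -/

namespace IsSlitHull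

variable {p q : ℝ} (h : IsSlitHull A p q)
include h

/-- For negative slit data, the positive reals lie in `Ω`. [folklore] -/
theorem ofReal_mem_slitDomain_of_pos (hneg : max p q < 0) {x : ℝ} (hx : 0 ≤ x) :
    (x : ℂ) ∈ slitDomain A p q := by
  rw [h.ofReal_mem_slitDomain_iff]
  intro hxI
  have := (Set.mem_uIcc.1 hxI).elim (fun h' ↦ h'.2.trans (le_max_right p q)) fun h' ↦ h'.2.trans (le_max_left p q)
  linarith

/-- **`E` is positive on `(0, ∞)` for negative slit data**: `E` is real, continuous and injective
on the real ray `(max p q, ∞) ∋ 0`, hence strictly monotone there, and increasing since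
`E'(0) > 0`. [folklore] -/
theorem ext_ofReal_re_pos (hneg : max p q < 0) {x : ℝ} (hx : 0 < x) : 0 < (h.ext x).re := by
  -- the real function `φ t = re E(t)` on `I = (max p q, x + 1)`
  set φ : ℝ → ℝ := fun t ↦ (h.ext t).re with hφ
  set a := max p q with ha
  have hmemΩ : ∀ t ∈ Ioo a (x + 1), (t : ℂ) ∈ slitDomain A p q := fun t ht ↦ by
    rw [h.ofReal_mem_slitDomain_iff]
    intro htI
    have := (Set.mem_uIcc.1 htI).elim (fun h' ↦ h'.2.trans (le_max_right p q))
      fun h' ↦ h'.2.trans (le_max_left p q)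
    linarith [ht.1]
  have hφc : ContinuousOn φ (Ioo a (x + 1)) := by
    refine continuous_re.comp_continuousOn (h.continuousOn_ext.comp continuous_ofReal.continuousOn ?_)
    exact fun t ht ↦ hmemΩ t ht
  have hφi : InjOn φ (Ioo a (x + 1)) := by
    intro t ht t' ht' heq
    have h1 : h.ext t = h.ext t' := by
      apply Complex.ext heq
      rw [h.ext_ofReal_im (hmemΩ t ht), h.ext_ofReal_im (hmemΩ t' ht')]
    exact ofReal_inj.1 (h.injOn_ext (hmemΩ t ht) (hmemΩ t' ht') h1)
  have hax : a < x + 1 := by linarith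
  -- `φ` is increasing near `0`
  have h0I : (0 : ℝ) ∈ Ioo a (x + 1) := ⟨hneg, by linarith⟩
  have hderiv : HasDerivAt φ h.restrictionDeriv 0 := by
    have hd : HasDerivAt h.ext (h.restrictionDeriv : ℂ) ((0 : ℝ) : ℂ) := by
      rw [ofReal_zero, ← h.deriv_ext_zero]
      exact (h.differentiableAt_ext h.zero_mem_slitDomain).hasDerivAt
    have := hd.real_of_complex
    simpa using this
  obtain ⟨t, ht0, htI, hφt⟩ : ∃ t, 0 < t ∧ t ∈ Ioo a (x + 1) ∧ φ 0 < φ t := by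
    have hsl := hderiv.tendsto_slope_zero_right
    have hev := (tendsto_order.1 hsl).1 0 h.restrictionDeriv_pos
    have hev2 : ∀ᶠ t : ℝ in 𝓝[>] 0, t ∈ Ioo a (x + 1) :=
      nhdsWithin_le_nhds (isOpen_Ioo.mem_nhds h0I)
    obtain ⟨t, ⟨hslope, htI⟩, ht⟩ := ((hev.and hev2).and self_mem_nhdsWithin).exists
    refine ⟨t, ht, htI, ?_⟩
    rw [zero_add, smul_eq_mul] at hslope
    have := (mul_pos_iff_of_pos_left (inv_pos.2 ht)).1 hslope
    linarith
  -- so `φ` is strictly monotone, and `φ x > φ 0 = 0`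
  have hφ0 : φ 0 = 0 := by simp [hφ, h.ext_zero]
  rcases hφc.strictMonoOn_of_injOn_Ioo hax hφi with hmono | hanti
  · have := hmono h0I ⟨hneg.trans hx, by linarith⟩ hx
    rwa [hφ0] at this
  · have := hanti h0I htI ht0
    linarith

/-- `E` maps the lower part of `Ω` into the lower half-plane. [folklore] -/
theorem ext_im_neg {z : ℂ} (hz : z ∈ slitDomain A p q) (hzim : z.im < 0) : (h.ext z).im < 0 := by
  have hcz : conj z ∈ upperHalfPlaneSet \ A := by
    rw [← h.slitDomain_inter_eq]
    exact ⟨conj_mem_slitDomain_iff.2 hz, show 0 < (conj z).im by rw [conj_im]; linarith⟩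
  have := h.mapsTo_ext hcz
  rw [h.ext_conj hz] at this
  have : 0 < (conj (h.ext z)).im := this
  rw [conj_im] at this
  linarith

/-- `E(z)` is real only for real `z ∈ Ω`. [folklore] -/
theorem im_eq_zero_of_ext_im_eq_zero {z : ℂ} (hz : z ∈ slitDomain A p q) (hE : (h.ext z).im = 0) :
    z.im = 0 := by
  rcases lt_trichotomy z.im 0 with hlt | heq | hgt
  · exact absurd hE (h.ext_im_neg hz hlt).ne
  · exact heq
  · have : 0 < (h.ext z).im := h.mapsTo_ext ⟨hgt, (h.mem_slitDomain_iff_of_im_pos hgt).1 hz⟩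
    exact absurd hE this.ne'

/-- The packaged properties of the constructed `Φ_A` of a one-sided hull. [folklore] -/
theorem exists_restrictionMap_tendsto :
    ∃ Φ : ConformalEquiv (upperHalfPlaneSet \ A) upperHalfPlaneSet, IsRestrictionMap A Φ ∧
      Tendsto Φ.symm (𝓝[upperHalfPlaneSet] 0) (𝓝 0) ∧
      Tendsto Φ.symm (cocompact ℂ ⊓ 𝓟 upperHalfPlaneSet) (cocompact ℂ) ∧
      ∃ d : ℝ, 0 < d ∧ d ≤ 1 ∧ HasRestrictionDeriv A Φ d :=
  ⟨h.restrictionMap, h.isRestrictionMap, h.tendsto_symm_nhdsWithin_zero, h.tendsto_symm_cocompact,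
    h.exists_hasRestrictionDeriv_restrictionMap⟩

end IsSlitHull

/-! ### The empty hull -/

/-- The packaged properties of `Φ_∅ = id`. [folklore] -/
theorem exists_restrictionMap_tendsto_empty :
    ∃ Φ : ConformalEquiv (upperHalfPlaneSet \ ∅) upperHalfPlaneSet, IsRestrictionMap ∅ Φ ∧
      Tendsto Φ.symm (𝓝[upperHalfPlaneSet] 0) (𝓝 0) ∧
      Tendsto Φ.symm (cocompact ℂ ⊓ 𝓟 upperHalfPlaneSet) (cocompact ℂ) ∧
      ∃ d : ℝ, 0 < d ∧ d ≤ 1 ∧ HasRestrictionDeriv ∅ Φ d := by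
  refine ⟨restrictionMapEmpty, isRestrictionMap_empty, ?_, ?_, 1, one_pos, le_rfl, hasRestrictionDeriv_empty⟩
  · have : ∀ w, restrictionMapEmpty.symm w = w := fun w ↦ rfl
    exact (tendsto_id.mono_left nhdsWithin_le_nhds).congr fun w ↦ (this w).symm
  · have : ∀ w, restrictionMapEmpty.symm w = w := fun w ↦ rfl
    exact (tendsto_id.mono_left inf_le_left).congr fun w ↦ (this w).symm

/-! ### Two-sided hulls: `A = B · A₋` with `B = E₋(A₊)` -/

namespace IsStarHull

variable (hA : IsStarHull A)
include hA

/-- A `*`-hull has no floating pieces (`HullApproximation`). [folklore] -/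
theorem isConnected_union_im_nonpos : IsConnected (A ∪ {z : ℂ | z.im ≤ 0}) :=
  hA.isBoundedHull.isConnected_union_im_nonpos

/-- The `−`-part `A₋ = sidePart A (-1)` of `A` is a `−`-hull. [folklore] -/
theorem isMinusHull_minusPart : IsMinusHull (sidePart A (-1)) :=
  hA.isMinusHull_sidePart hA.isConnected_union_im_nonpos

/-- The `+`-part `A₊ = sidePart A 1` of `A` is a `+`-hull. [folklore] -/
theorem isPlusHull_plusPart : IsPlusHull (sidePart A 1) :=
  hA.isPlusHull_sidePart hA.isConnected_union_im_nonpos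

/-- `A = A₊ ∪ A₋`. [folklore] -/
theorem plusPart_union_minusPart : sidePart A 1 ∪ sidePart A (-1) = A :=
  hA.sidePart_union hA.isConnected_union_im_nonpos one_ne_zero

/-- The free endpoint `p₋ = x₁/2` of the slit data of `A₋`. [folklore] -/
def pMinus (A : Set ℂ) : ℝ := sSup (realTrace (sidePart A (-1))) / 2

/-- The endpoint `q₋ = x₀` of the slit data of `A₋`. [folklore] -/
def qMinus (A : Set ℂ) : ℝ := sInf (realTrace (sidePart A (-1)))

/-- A nonempty `−`-part is a one-sided hull. [folklore] -/
theorem minusSlit (hne : (sidePart A (-1)).Nonempty) : IsSlitHull (sidePart A (-1)) (pMinus A) (qMinus A) :=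
  hA.isMinusHull_minusPart.isSlitHull hne

omit hA in
/-- The slit data of `A₋` are negative. [folklore] -/
theorem slit_neg (hA : IsStarHull A) (hne : (sidePart A (-1)).Nonempty) : max (pMinus A) (qMinus A) < 0 :=
  hA.isMinusHull_minusPart.slit_neg hne

/-- **`A₊ ⊆ Ω₋`**: the `+`-part lies in the symmetrized slit domain of the `−`-part. [folklore] -/
theorem plusPart_subset_slitDomain (hne : (sidePart A (-1)).Nonempty) :
    sidePart A 1 ⊆ slitDomain (sidePart A (-1)) (pMinus A) (qMinus A) := by
  intro a ha
  have hm := hA.minusSlit hne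
  have him : 0 ≤ a.im := hA.isBoundedHull.im_nonneg ha.1
  rcases him.lt_or_eq with hlt | heq
  · exact (hm.mem_slitDomain_iff_of_im_pos hlt).2 fun ha' ↦ Set.disjoint_left.1 hA.disjoint_sidePart ha ha'
  · have hare : ((a.re : ℝ) : ℂ) = a := Complex.ext (by simp) (by simp [heq])
    rw [← hare] at ha ⊢
    have hpos := hA.pos_of_ofReal_mem_sidePart ha
    rw [one_mul] at hpos
    exact hm.ofReal_mem_slitDomain_of_pos (hA.slit_neg hne) hpos.le

omit hA in
/-- `ℍ ∖ A ⊆ ℍ ∖ A₋`. [folklore] -/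
theorem diff_subset_diff_minusPart : upperHalfPlaneSet \ A ⊆ upperHalfPlaneSet \ sidePart A (-1) :=
  fun _ hz ↦ ⟨hz.1, fun h ↦ hz.2 (sidePart_subset A _ h)⟩

/-- **The `+`-hull `B = E₋(A₊)`**, the image of the `+`-part under the symmetric extension of
`Φ_{A₋}`; `A = B · A₋`. [cite: LawlerSchrammWerner2003Restriction, §2 p. 8 (A = A₁ · A₂)] -/
def plusImage (hne : (sidePart A (-1)).Nonempty) : Set ℂ :=
  (hA.minusSlit hne).ext '' sidePart A 1

/-- `B` is compact. [folklore] -/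
theorem isCompact_plusImage (hne : (sidePart A (-1)).Nonempty) : IsCompact (hA.plusImage hne) :=
  ((hA.isBoundedHull.isCompact).of_isClosed_subset
    (hA.isClosed_sidePart one_ne_zero) (sidePart_subset A 1)).image_of_continuousOn
    ((hA.minusSlit hne).continuousOn_ext.mono (hA.plusPart_subset_slitDomain hne))

/-- `0 ∉ B`. [folklore] -/
theorem zero_notMem_plusImage (hne : (sidePart A (-1)).Nonempty) : (0 : ℂ) ∉ hA.plusImage hne := by
  rintro ⟨a, ha, ha0⟩
  have hm := hA.minusSlit hne
  rw [← hm.ext_zero] at ha0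
  have := hm.injOn_ext (hA.plusPart_subset_slitDomain hne ha) hm.zero_mem_slitDomain ha0
  exact hA.zero_notMem (this ▸ ha.1)

/-- The real points of `B` are positive (`E₋` is increasing on the real ray through `0`). [folklore] -/
theorem pos_of_ofReal_mem_plusImage (hne : (sidePart A (-1)).Nonempty) {x : ℝ}
    (hx : (x : ℂ) ∈ hA.plusImage hne) : 0 < x := by
  obtain ⟨a, ha, hax⟩ := hx
  have hm := hA.minusSlit hne
  have haΩ := hA.plusPart_subset_slitDomain hne ha
  have haim : a.im = 0 := hm.im_eq_zero_of_ext_im_eq_zero haΩ (by rw [hax, ofReal_im])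
  have hare : ((a.re : ℝ) : ℂ) = a := Complex.ext (by simp) (by simp [haim])
  rw [← hare] at ha hax
  have hpos := hA.pos_of_ofReal_mem_sidePart ha
  rw [one_mul] at hpos
  have := hm.ext_ofReal_re_pos (hA.slit_neg hne) hpos
  rwa [hax, ofReal_re] at this

/-- **`E₋(ℍ ∖ A) = ℍ ∖ B`.** [folklore] -/
theorem image_ext_diff (hne : (sidePart A (-1)).Nonempty) :
    (hA.minusSlit hne).ext '' (upperHalfPlaneSet \ A) = upperHalfPlaneSet \ hA.plusImage hne := by
  have hm := hA.minusSlit hne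
  apply Subset.antisymm
  · rintro _ ⟨z, hz, rfl⟩
    have hzm := diff_subset_diff_minusPart hz
    refine ⟨hm.mapsTo_ext hzm, ?_⟩
    rintro ⟨a, ha, haz⟩
    have := hm.injOn_ext (hA.plusPart_subset_slitDomain hne ha) (hm.diff_subset_slitDomain hzm) haz
    exact hz.2 (this ▸ ha.1)
  · rintro w ⟨hw, hwB⟩
    obtain ⟨z, hz, rfl⟩ := hm.surjOn_ext hw
    refine ⟨z, ⟨hz.1, fun hzA ↦ ?_⟩, rfl⟩
    rcases (hA.plusPart_union_minusPart).symm.subset hzA with hz' | hz'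
    · exact hwB ⟨z, hz', rfl⟩
    · exact hz.2 hz'

/-- **`B` is a `+`-hull.** [cite: LawlerSchrammWerner2003Restriction, §2 p. 8 (A = A₁ · A₂)] -/
theorem isPlusHull_plusImage (hne : (sidePart A (-1)).Nonempty) : IsPlusHull (hA.plusImage hne) := by
  have hm := hA.minusSlit hne
  have hBc : IsClosed (hA.plusImage hne) := (hA.isCompact_plusImage hne).isClosed
  have hU := hA.1.2.2
  have hUo : IsOpen (upperHalfPlaneSet \ A) := isOpen_upperHalfPlaneSet.sdiff hA.isBoundedHull.isClosed
  have hUΩ : upperHalfPlaneSet \ A ⊆ slitDomain (sidePart A (-1)) (pMinus A) (qMinus A) :=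
    diff_subset_diff_minusPart.trans hm.diff_subset_slitDomain
  refine ⟨⟨⟨(hA.isCompact_plusImage hne).isBounded, ?_, ?_⟩, hA.zero_notMem_plusImage hne⟩,
    fun x hx ↦ hA.pos_of_ofReal_mem_plusImage hne hx⟩
  · -- `B = cl(B ∩ ℍ)`
    refine Subset.antisymm (closure_minimal inter_subset_left hBc) ?_
    have hcl : closure (sidePart A 1 ∩ upperHalfPlaneSet) = sidePart A 1 :=
      hA.closure_sidePart_inter hA.isConnected_union_im_nonpos one_ne_zero
    have h1 : hA.plusImage hne ⊆ closure (hm.ext '' (sidePart A 1 ∩ upperHalfPlaneSet)) := by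
      have hc : ContinuousOn hm.ext (closure (sidePart A 1 ∩ upperHalfPlaneSet)) := by
        rw [hcl]; exact hm.continuousOn_ext.mono (hA.plusPart_subset_slitDomain hne)
      have := hc.image_closure
      rw [hcl] at this
      exact this
    refine h1.trans (closure_mono ?_)
    rintro _ ⟨a, ⟨ha, haH⟩, rfl⟩
    exact ⟨⟨a, ha, rfl⟩, hm.mapsTo_ext ⟨haH, fun ha' ↦ Set.disjoint_left.1 hA.disjoint_sidePart ha ha'⟩⟩
  · -- `ℍ ∖ B = E₋(ℍ ∖ A)` is simply connected
    rw [← hA.image_ext_diff hne]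
    have hd : DifferentiableOn ℂ hm.ext (upperHalfPlaneSet \ A) := hm.differentiableOn_ext.mono hUΩ
    have hi : InjOn hm.ext (upperHalfPlaneSet \ A) := hm.injOn_ext.mono hUΩ
    set φ : ConformalEquiv (upperHalfPlaneSet \ A) (hm.ext '' (upperHalfPlaneSet \ A)) :=
      ConformalEquiv.ofBijOn hm.ext hd hi.bijOn_image
        (Complex.differentiableOn_invFunOn_image hUo hd hi fun z hz ↦ hm.deriv_ext_ne_zero (hUΩ hz))
    exact φ.isSimplyConnected_iff.1 hU

/-- `B` is nonempty when `A₊` is. [folklore] -/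
theorem plusImage_nonempty (hne : (sidePart A (-1)).Nonempty) (hne' : (sidePart A 1).Nonempty) :
    (hA.plusImage hne).Nonempty :=
  hne'.image _

/-- The one-sided structure of `B`. [folklore] -/
theorem plusSlit (hne : (sidePart A (-1)).Nonempty) (hne' : (sidePart A 1).Nonempty) :
    IsSlitHull (hA.plusImage hne) (sInf (realTrace (hA.plusImage hne)) / 2) (sSup (realTrace (hA.plusImage hne))) :=
  (hA.isPlusHull_plusImage hne).isSlitHull (hA.plusImage_nonempty hne hne')

/-- **The inner equivalence `E₋| : ℍ ∖ A → ℍ ∖ B`.** [folklore] -/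
def innerEquiv (hne : (sidePart A (-1)).Nonempty) :
    ConformalEquiv (upperHalfPlaneSet \ A) (upperHalfPlaneSet \ hA.plusImage hne) :=
  have hm := hA.minusSlit hne
  have hUo : IsOpen (upperHalfPlaneSet \ A) := isOpen_upperHalfPlaneSet.sdiff hA.isBoundedHull.isClosed
  have hUΩ : upperHalfPlaneSet \ A ⊆ slitDomain (sidePart A (-1)) (pMinus A) (qMinus A) :=
    diff_subset_diff_minusPart.trans hm.diff_subset_slitDomain
  have hd : DifferentiableOn ℂ hm.ext (upperHalfPlaneSet \ A) := hm.differentiableOn_ext.mono hUΩ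
  have hi : InjOn hm.ext (upperHalfPlaneSet \ A) := hm.injOn_ext.mono hUΩ
  ConformalEquiv.ofBijOn hm.ext hd (hA.image_ext_diff hne ▸ hi.bijOn_image) (by
    rw [← hA.image_ext_diff hne]
    exact Complex.differentiableOn_invFunOn_image hUo hd hi fun z hz ↦ hm.deriv_ext_ne_zero (hUΩ hz))

/-- The inner equivalence acts as `E₋`. [folklore] -/
theorem innerEquiv_apply (hne : (sidePart A (-1)).Nonempty) (z : ℂ) :
    hA.innerEquiv hne z = (hA.minusSlit hne).ext z := rfl

/-- On `ℍ ∖ B`, the inverse of the inner equivalence is `Φ_{A₋}⁻¹`. [folklore] -/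
theorem innerEquiv_symm_eq (hne : (sidePart A (-1)).Nonempty) {v : ℂ}
    (hv : v ∈ upperHalfPlaneSet \ hA.plusImage hne) :
    (hA.innerEquiv hne).symm v = (hA.minusSlit hne).restrictionMap.symm v := by
  have hm := hA.minusSlit hne
  have h1 : (hA.innerEquiv hne).symm v ∈ upperHalfPlaneSet \ A := (hA.innerEquiv hne).symm_mapsTo hv
  have h2 : hm.restrictionMap.symm v ∈ upperHalfPlaneSet \ sidePart A (-1) := hm.symm_mem hv.1
  refine hm.injOn_ext (hm.diff_subset_slitDomain (diff_subset_diff_minusPart h1))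
    (hm.diff_subset_slitDomain h2) ?_
  have e1 : hm.ext ((hA.innerEquiv hne).symm v) = v := (hA.innerEquiv hne).apply_symm_apply hv
  rw [e1, hm.ext_symm_apply hv.1]

/-- **`Φ_A := Φ_B ∘ E₋|`** for a two-sided hull. [cite: LawlerSchrammWerner2003Restriction, §2 p. 8 (Φ_{A₁·A₂} = Φ_{A₁} ∘ Φ_{A₂})] -/
def twoSidedMap (hne : (sidePart A (-1)).Nonempty) (hne' : (sidePart A 1).Nonempty) :
    ConformalEquiv (upperHalfPlaneSet \ A) upperHalfPlaneSet :=
  (hA.innerEquiv hne).trans (hA.plusSlit hne hne').restrictionMap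

/-- `Φ_A` acts as `E_B ∘ E₋`. [folklore] -/
theorem twoSidedMap_apply (hne : (sidePart A (-1)).Nonempty) (hne' : (sidePart A 1).Nonempty) (z : ℂ) :
    hA.twoSidedMap hne hne' z = (hA.plusSlit hne hne').ext ((hA.minusSlit hne).ext z) := rfl

/-- `Φ_A⁻¹ = E₋|⁻¹ ∘ Φ_B⁻¹`. [folklore] -/
theorem twoSidedMap_symm_apply (hne : (sidePart A (-1)).Nonempty) (hne' : (sidePart A 1).Nonempty) (w : ℂ) :
    (hA.twoSidedMap hne hne').symm w = (hA.innerEquiv hne).symm ((hA.plusSlit hne hne').restrictionMap.symm w) :=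
  rfl

/-- `E₋ → ∞` at `∞` within `ℍ ∖ A`, landing in `ℍ ∖ B`. [folklore] -/
theorem tendsto_ext_cocompact (hne : (sidePart A (-1)).Nonempty) :
    Tendsto (hA.minusSlit hne).ext (cocompact ℂ ⊓ 𝓟 (upperHalfPlaneSet \ A))
      (cocompact ℂ ⊓ 𝓟 (upperHalfPlaneSet \ hA.plusImage hne)) := by
  have hm := hA.minusSlit hne
  refine tendsto_inf.2 ⟨?_, tendsto_principal.2 (mem_inf_of_right fun z hz ↦ ?_)⟩
  · have := hm.isRestrictionMap.tendsto_cocompact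
    exact this.mono_left (inf_le_inf_left _ (principal_mono.2 diff_subset_diff_minusPart))
  · rw [← hA.image_ext_diff hne]
    exact mem_image_of_mem _ hz

/-- `E₋ → 0` at `0` within `ℍ ∖ A`, landing in `ℍ ∖ B`. [folklore] -/
theorem tendsto_ext_nhdsWithin_zero (hne : (sidePart A (-1)).Nonempty) :
    Tendsto (hA.minusSlit hne).ext (𝓝[upperHalfPlaneSet \ A] 0)
      (𝓝[upperHalfPlaneSet \ hA.plusImage hne] 0) := by
  have hm := hA.minusSlit hne
  refine tendsto_nhdsWithin_iff.2 ⟨?_, ?_⟩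
  · have := (hm.differentiableAt_ext hm.zero_mem_slitDomain).continuousAt.tendsto
    rw [hm.ext_zero] at this
    exact this.mono_left nhdsWithin_le_nhds
  · filter_upwards [self_mem_nhdsWithin] with z hz
    rw [← hA.image_ext_diff hne]
    exact mem_image_of_mem _ hz

/-- **`Φ_A` is a restriction map of the two-sided hull `A`.** [cite: LawlerSchrammWerner2003Restriction, §2 p. 8 (the maps Φ_A)] -/
theorem isRestrictionMap_twoSidedMap (hne : (sidePart A (-1)).Nonempty) (hne' : (sidePart A 1).Nonempty) :
    IsRestrictionMap A (hA.twoSidedMap hne hne') := by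
  have hm := hA.minusSlit hne
  have hB := hA.plusSlit hne hne'
  refine ⟨?_, ?_⟩
  · show Tendsto (fun z ↦ hB.ext (hm.ext z)) (𝓝[upperHalfPlaneSet \ A] 0) (𝓝 0)
    have h1 := (hB.differentiableAt_ext hB.zero_mem_slitDomain).continuousAt.tendsto
    rw [hB.ext_zero] at h1
    exact (h1.mono_left nhdsWithin_le_nhds).comp (hA.tendsto_ext_nhdsWithin_zero hne)
  · show Tendsto (fun z ↦ hB.ext (hm.ext z) / z) (cocompact ℂ ⊓ 𝓟 (upperHalfPlaneSet \ A)) (𝓝 1)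
    have h1 : Tendsto (fun z ↦ hB.ext (hm.ext z) / hm.ext z) (cocompact ℂ ⊓ 𝓟 (upperHalfPlaneSet \ A)) (𝓝 1) :=
      (hB.tendsto_ext_div.mono_left inf_le_left).comp (hA.tendsto_ext_cocompact hne)
    have h2 : Tendsto (fun z ↦ hm.ext z / z) (cocompact ℂ ⊓ 𝓟 (upperHalfPlaneSet \ A)) (𝓝 1) :=
      hm.tendsto_ext_div.mono_left inf_le_left
    have := h1.mul h2
    rw [mul_one] at this
    refine this.congr' ?_
    filter_upwards [mem_inf_of_right (mem_principal_self _)] with z hz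
    have hE0 : hm.ext z ≠ 0 := fun h0 ↦ by
      have : (0 : ℝ) < (hm.ext z).im := hm.mapsTo_ext (diff_subset_diff_minusPart hz)
      rw [h0] at this; simp at this
    show hB.ext (hm.ext z) / hm.ext z * (hm.ext z / z) = hB.ext (hm.ext z) / z
    rw [div_mul_div_comm, mul_comm (hm.ext z) z, ← div_mul_div_comm, div_self hE0, mul_one]

/-- `Φ_A⁻¹ → 0` at `0`, two-sided case. [folklore] -/
theorem tendsto_twoSidedMap_symm_zero (hne : (sidePart A (-1)).Nonempty) (hne' : (sidePart A 1).Nonempty) :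
    Tendsto (hA.twoSidedMap hne hne').symm (𝓝[upperHalfPlaneSet] 0) (𝓝 0) := by
  have hm := hA.minusSlit hne
  have hB := hA.plusSlit hne hne'
  have h1 : Tendsto hB.restrictionMap.symm (𝓝[upperHalfPlaneSet] 0)
      (𝓝[upperHalfPlaneSet \ hA.plusImage hne] 0) :=
    tendsto_nhdsWithin_iff.2 ⟨hB.tendsto_symm_nhdsWithin_zero,
      eventually_nhdsWithin_of_forall fun w hw ↦ hB.symm_mem hw⟩
  have h2 : Tendsto hm.restrictionMap.symm (𝓝[upperHalfPlaneSet \ hA.plusImage hne] 0) (𝓝 0) :=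
    hm.tendsto_symm_nhdsWithin_zero.mono_left (nhdsWithin_mono _ sdiff_subset)
  refine ((h2.comp h1).congr' ?_).congr (fun w ↦ (hA.twoSidedMap_symm_apply hne hne' w).symm)
  filter_upwards [self_mem_nhdsWithin] with w hw
  exact (hA.innerEquiv_symm_eq hne (hB.symm_mem hw)).symm

/-- `Φ_A⁻¹ → ∞` at `∞`, two-sided case. [folklore] -/
theorem tendsto_twoSidedMap_symm_cocompact (hne : (sidePart A (-1)).Nonempty) (hne' : (sidePart A 1).Nonempty) :
    Tendsto (hA.twoSidedMap hne hne').symm (cocompact ℂ ⊓ 𝓟 upperHalfPlaneSet) (cocompact ℂ) := by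
  have hm := hA.minusSlit hne
  have hB := hA.plusSlit hne hne'
  have h1 : Tendsto hB.restrictionMap.symm (cocompact ℂ ⊓ 𝓟 upperHalfPlaneSet)
      (cocompact ℂ ⊓ 𝓟 (upperHalfPlaneSet \ hA.plusImage hne)) :=
    tendsto_inf.2 ⟨hB.tendsto_symm_cocompact, tendsto_principal.2 (mem_inf_of_right fun w hw ↦ hB.symm_mem hw)⟩
  have h2 : Tendsto hm.restrictionMap.symm (cocompact ℂ ⊓ 𝓟 (upperHalfPlaneSet \ hA.plusImage hne)) (cocompact ℂ) :=
    hm.tendsto_symm_cocompact.mono_left (inf_le_inf_left _ (principal_mono.2 sdiff_subset))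
  refine ((h2.comp h1).congr' ?_).congr (fun w ↦ (hA.twoSidedMap_symm_apply hne hne' w).symm)
  filter_upwards [mem_inf_of_right (mem_principal_self _)] with w hw
  exact (hA.innerEquiv_symm_eq hne (hB.symm_mem hw)).symm

/-- **`Φ_A'(0) = Φ_B'(0) · Φ_{A₋}'(0)`**, two-sided case (chain rule at the boundary point `0`,
where both extensions are holomorphic). [cite: LawlerSchrammWerner2003Restriction, §2 (2.4) p. 7] -/
theorem hasRestrictionDeriv_twoSidedMap (hne : (sidePart A (-1)).Nonempty) (hne' : (sidePart A 1).Nonempty) :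
    HasRestrictionDeriv A (hA.twoSidedMap hne hne')
      ((hA.plusSlit hne hne').restrictionDeriv * (hA.minusSlit hne).restrictionDeriv) := by
  have hm := hA.minusSlit hne
  have hB := hA.plusSlit hne hne'
  show Tendsto (fun z ↦ hB.ext (hm.ext z) / z) (𝓝[upperHalfPlaneSet \ A] 0) _
  have h1 : Tendsto (fun z ↦ hB.ext (hm.ext z) / hm.ext z) (𝓝[upperHalfPlaneSet \ A] 0)
      (𝓝 (hB.restrictionDeriv : ℂ)) :=
    hB.hasRestrictionDeriv.comp (hA.tendsto_ext_nhdsWithin_zero hne)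
  have h2 : Tendsto (fun z ↦ hm.ext z / z) (𝓝[upperHalfPlaneSet \ A] 0) (𝓝 (hm.restrictionDeriv : ℂ)) :=
    hm.hasRestrictionDeriv.mono_left (nhdsWithin_mono _ diff_subset_diff_minusPart)
  have := h1.mul h2
  rw [← ofReal_mul] at this
  refine this.congr' ?_
  filter_upwards [self_mem_nhdsWithin] with z hz
  have hE0 : hm.ext z ≠ 0 := fun h0 ↦ by
    have : (0 : ℝ) < (hm.ext z).im := hm.mapsTo_ext (diff_subset_diff_minusPart hz)
    rw [h0] at this; simp at this
  show hB.ext (hm.ext z) / hm.ext z * (hm.ext z / z) = hB.ext (hm.ext z) / z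
  rw [div_mul_div_comm, mul_comm (hm.ext z) z, ← div_mul_div_comm, div_self hE0, mul_one]

/-- **`A = B · A₋`** in the sense of `RestrictionConfig.IsHullProduct`:
`ℍ ∖ A = {z ∈ ℍ ∖ A₋ : Φ_{A₋}(z) ∉ B}`. [cite: LawlerSchrammWerner2003Restriction, §2 p. 8 (A = A₁ · A₂)] -/
theorem isHullProduct_plusImage (hne : (sidePart A (-1)).Nonempty) :
    RestrictionConfig.IsHullProduct (hA.plusImage hne) (sidePart A (-1)) A := by
  have hm := hA.minusSlit hne
  refine ⟨hA, hm.restrictionMap, hm.isRestrictionMap, ?_⟩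
  ext z
  simp only [mem_setOf_eq, IsSlitHull.restrictionMap_apply]
  constructor
  · intro hz
    refine ⟨diff_subset_diff_minusPart hz, fun hB ↦ ?_⟩
    have : hm.ext z ∈ upperHalfPlaneSet \ hA.plusImage hne := by
      rw [← hA.image_ext_diff hne]; exact mem_image_of_mem _ hz
    exact this.2 hB
  · rintro ⟨hz, hzB⟩
    refine ⟨hz.1, fun hzA ↦ ?_⟩
    rcases (hA.plusPart_union_minusPart).symm.subset hzA with hz' | hz'
    · exact hzB ⟨z, hz', rfl⟩
    · exact hz.2 hz'

/-- **Existence of `Φ_A` with the behaviour of `Φ_A⁻¹` at `0` and `∞`, for every `*`-hull** (by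
cases: empty, one-sided, two-sided). [cite: LawlerSchrammWerner2003Restriction, §2 p. 8 (the maps Φ_A)] -/
theorem exists_restrictionMap_tendsto :
    ∃ Φ : ConformalEquiv (upperHalfPlaneSet \ A) upperHalfPlaneSet, IsRestrictionMap A Φ ∧
      Tendsto Φ.symm (𝓝[upperHalfPlaneSet] 0) (𝓝 0) ∧
      Tendsto Φ.symm (cocompact ℂ ⊓ 𝓟 upperHalfPlaneSet) (cocompact ℂ) ∧
      ∃ d : ℝ, 0 < d ∧ d ≤ 1 ∧ HasRestrictionDeriv A Φ d := by
  by_cases hne : (sidePart A (-1)).Nonempty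
  · by_cases hne' : (sidePart A 1).Nonempty
    · exact ⟨hA.twoSidedMap hne hne', hA.isRestrictionMap_twoSidedMap hne hne',
        hA.tendsto_twoSidedMap_symm_zero hne hne', hA.tendsto_twoSidedMap_symm_cocompact hne hne',
        _, mul_pos (hA.plusSlit hne hne').restrictionDeriv_pos (hA.minusSlit hne).restrictionDeriv_pos,
        mul_le_one₀ (hA.plusSlit hne hne').restrictionDeriv_le_one (hA.minusSlit hne).restrictionDeriv_pos.le
          (hA.minusSlit hne).restrictionDeriv_le_one,
        hA.hasRestrictionDeriv_twoSidedMap hne hne'⟩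
    · -- `A = A₋` is a nonempty `−`-hull
      have heq : sidePart A (-1) = A := by
        have h1 := hA.plusPart_union_minusPart
        rwa [not_nonempty_iff_eq_empty.1 hne', empty_union] at h1
      have h := hA.minusSlit hne
      rw [heq] at h
      exact h.exists_restrictionMap_tendsto
  · have heq : sidePart A 1 = A := by
      have h1 := hA.plusPart_union_minusPart
      rwa [not_nonempty_iff_eq_empty.1 hne, union_empty] at h1
    by_cases hAne : A.Nonempty
    · -- `A = A₊` is a nonempty `+`-hull
      have hplus : IsPlusHull A := heq ▸ hA.isPlusHull_plusPart
      exact (hplus.isSlitHull hAne).exists_restrictionMap_tendsto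
    · rw [not_nonempty_iff_eq_empty] at hAne
      subst hAne
      exact exists_restrictionMap_tendsto_empty

end IsStarHull

/-! ### The named fact `A = A₁ · A₂`, discharged -/

/-- **[LSW] §2 p. 8: `A = A₁ · A₂` with `A₁ ∈ 𝒬₊`, `A₂ ∈ 𝒬₋`** (`Literature.Probability.RandomPlanarGeometry.IsStarHull.exists_isHullProduct_plus_minus`
holds): `A₂ = A₋` is the union of the components of `A` meeting `(-∞, 0)` and
`A₁ = E₋(A₊)` the image of the other components under the symmetric extension of `Φ_{A₋}`
(degenerate cases: `A = A · ∅` for `A ∈ 𝒬₊`, `A = ∅ · A` for `A ∈ 𝒬₋`).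
[cite: LawlerSchrammWerner2003Restriction, §2 p. 8 (±-hulls, A = A₁ · A₂)] -/
theorem IsStarHull.exists_isHullProduct_plus_minus_holds : IsStarHull.exists_isHullProduct_plus_minus := by
  intro A hA
  by_cases hne : (sidePart A (-1)).Nonempty
  · by_cases hne' : (sidePart A 1).Nonempty
    · exact ⟨hA.plusImage hne, sidePart A (-1), hA.isPlusHull_plusImage hne, hA.isMinusHull_minusPart,
        hA.isHullProduct_plusImage hne⟩
    · -- `A = ∅ · A`, `A ∈ 𝒬₋`
      have heq : sidePart A (-1) = A := by
        have h1 := hA.plusPart_union_minusPart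
        rwa [not_nonempty_iff_eq_empty.1 hne', empty_union] at h1
      obtain ⟨Φ, hΦ, -⟩ := hA.exists_restrictionMap_tendsto
      refine ⟨∅, A, isPlusHull_empty, heq ▸ hA.isMinusHull_minusPart, hA, Φ, hΦ, ?_⟩
      ext z
      simp
  · -- `A = A · ∅`, `A ∈ 𝒬₊`
    have heq : sidePart A 1 = A := by
      have h1 := hA.plusPart_union_minusPart
      rwa [not_nonempty_iff_eq_empty.1 hne, union_empty] at h1
    exact ⟨A, ∅, heq ▸ hA.isPlusHull_plusPart, isMinusHull_empty, RestrictionConfig.isHullProduct_empty hA⟩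

end Literature.Probability.RandomPlanarGeometry
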